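import Mathlib
import Summits.Ventures.HodgeRepro2.T5HaarDoubleCosetVolume

/-!
# Inversion-invariant Haar measure: `#(KgK/K) = #(Kg⁻¹K/K)`

For an inversion-invariant Haar measure (`MeasureTheory.Measure.IsInvInvariant`, the case of a
UNIMODULAR group, e.g. any reductive `p`-adic group) the double cosets `KgK` and
`(KgK)⁻¹ = Kg⁻¹K` have the same volume, hence, by `T5HaarDoubleCosetVolume`, the same number of
left cosets of `K`:

  `#(KgK/K) = #(Kg⁻¹K/K)`   (`ncard_orbit_inv_eq`).

This counting identity is exactly what makes the anti-involution `T_g ↦ T_{g⁻¹}` of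
`T5HeckeTranspose` the ADJOINT of the Hecke action for the pairing between a representation and
its smooth dual (`T5HeckeMatrixCoefficient` / `T5HeckeDualMatrixCoefficient` carry the factors
`#(KgK/K)` and `#(Kg⁻¹K/K)` respectively).  Without inversion invariance the two counts differ
by the modular character.
-/

namespace Summit.Ventures.HodgeRepro2.T5HaarDoubleCosetInverse

open MeasureTheory T5HaarDoubleCosetVolume

section Group

variable {G : Type*} [Group G]

/-- `(KgK)⁻¹ = Kg⁻¹K`. -/
theorem doubleCosetSet_inv (K : Subgroup G) (g : G) :
    (doubleCosetSet K g)⁻¹ = doubleCosetSet K g⁻¹ := by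
  ext y
  rw [Set.mem_inv, mem_doubleCosetSet_iff, mem_doubleCosetSet_iff]
  constructor
  · rintro ⟨κ₁, hκ₁, κ₂, hκ₂, h⟩
    refine ⟨κ₂⁻¹, K.inv_mem hκ₂, κ₁⁻¹, K.inv_mem hκ₁, ?_⟩
    rw [← inv_inv y, h, mul_inv_rev, mul_inv_rev, mul_assoc]
  · rintro ⟨κ₁, hκ₁, κ₂, hκ₂, h⟩
    refine ⟨κ₂⁻¹, K.inv_mem hκ₂, κ₁⁻¹, K.inv_mem hκ₁, ?_⟩
    rw [h, mul_inv_rev, mul_inv_rev, inv_inv, mul_assoc]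

end Group

section Haar

variable {G : Type*} [Group G] [TopologicalSpace G] [IsTopologicalGroup G] [MeasurableSpace G]
  [BorelSpace G]

/-- For an inversion-invariant measure, `μ(Kg⁻¹K) = μ(KgK)`. -/
theorem measure_doubleCosetSet_inv (μ : Measure G) [μ.IsInvInvariant] (K : Subgroup G) (g : G) :
    μ (doubleCosetSet K g⁻¹) = μ (doubleCosetSet K g) := by
  rw [← doubleCosetSet_inv, Measure.measure_inv]

/-- THE COUNTING FORM OF UNIMODULARITY: for `K` compact open and an inversion-invariant Haar
measure `μ`, `#(KgK/K) = #(Kg⁻¹K/K)`. -/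
theorem ncard_orbit_inv_eq (μ : Measure G) [μ.IsHaarMeasure] [μ.IsInvInvariant] {K : Subgroup G}
    (hopen : IsOpen (K : Set G)) (hcpt : IsCompact (K : Set G)) (g : G) :
    (MulAction.orbit K ((g⁻¹ : G) : G ⧸ K)).ncard = (MulAction.orbit K (g : G ⧸ K)).ncard := by
  have h := measure_doubleCosetSet_inv μ K g
  rw [measure_doubleCosetSet_of_isOpen_of_isCompact μ hopen hcpt,
    measure_doubleCosetSet_of_isOpen_of_isCompact μ hopen hcpt] at h
  have h' : μ K * ((MulAction.orbit K ((g⁻¹ : G) : G ⧸ K)).ncard : ENNReal) =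
      μ K * ((MulAction.orbit K (g : G ⧸ K)).ncard : ENNReal) := by
    rw [mul_comm, h, mul_comm]
  have h'' := (ENNReal.mul_right_inj (measure_pos_of_isOpen μ hopen).ne'
    (measure_ne_top_of_isCompact μ hcpt)).1 h'
  exact_mod_cast h''

end Haar

end Summit.Ventures.HodgeRepro2.T5HaarDoubleCosetInverse
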